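import Literature.ModelTheory.FiniteModelTheory.PPInterpretation
import HarnessLib

/-!
# Gadget replacement over a LIST of constraints: the gadget system of a pp-power

Topic `Literature/ModelTheory/FiniteModelTheory`; support file for the discharge of the named fact
`cspLanguage_karpReducible_of_ppConstructs` of `PPInterpretation.lean` (Barto–Opršal–Pinsker, *The
wonderland of reflections* [BartoOprsalPinsker2017], Prop. 3.1 / Cor. 3.5; the gadget construction is
the one of Bulatov–Jeavons–Krokhin that Prop. 3.1 cites). `PPInterpretation.lean` proves the reduction
property of gadget replacement for the QUOTIENT instance `P.Gadget ι` (variables identified along the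
equality atoms, indexed by the bundled constraints of `ι`); a polynomial-time machine, however, reads
the constraints of a table instance as a LIST and must not shrink the universe by a quotient it would
have to enumerate. This file redoes the construction in exactly the shape the machine
(`PPInterpretationProofs.lean`) computes:

* `PPPower.Con br n` — a constraint `⟨s, v⟩` (relation symbol `s` of the instance vocabulary `br`,
  scope `v : Fin (arity s) → Fin n`) of a table instance on `Fin n`; `PPPower.conList R` lists the
  constraints holding in the tables `R` (`mem_conList_iff`);
* for a list `C` of constraints: the variables `P.SysVar C = (Fin n × Fin d) ⊕ Σ i, Fin eᵢ`
  (`d` copies of every element, and for the `i`-th LISTED constraint a fresh block of variables for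
  the `∃` of the pp-definition of its symbol — blocks are indexed by list position, so no quotient and
  no ranking is needed), the placement `P.sysLoc C i` of the variables of gadget `i`
  (`= PPPower.gadgetAssign` in this indexing), the GADGET SYSTEM `P.Solves C G` (an assignment
  `G : SysVar → M` satisfies every relational atom and every equality atom of every gadget) and
  THEOREM A `exists_solves_iff`: the system is solvable in `M` iff the instance maps homomorphically
  to the pp-power `P.Carrier M` (the proof of `PPPower.nonempty_gadget_hom_iff`, verbatim in the new
  indexing);
* for a map `rep : SysVar → SysVar` choosing REPRESENTATIVES of the classes of the equivalence
  generated by the equality atoms (`SysEdge`; hypotheses `rep_eq_of_sysEdge`, `eqvGen_rep`): the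
  `ar`-structure `P.sysStructure C rep` on ALL of `SysVar` whose tuples are the images under `rep` of
  the relational atoms (non-representatives stay as isolated points) and THEOREM B
  `nonempty_sysHom_iff_exists_solves`: it maps homomorphically to `M` iff the system is solvable.
  Together: `Hom(sysStructure, M) ≠ ∅ ↔ Hom(instance, P.Carrier M) ≠ ∅` (`nonempty_sysHom_iff`).

## References

* L. Barto, J. Opršal, M. Pinsker, *The wonderland of reflections*, Israel J. Math. 223 (2018)
  = arXiv:1510.04521, Prop. 3.1, Cor. 3.5. [BartoOprsalPinsker2017]
* A. Bulatov, P. Jeavons, A. Krokhin, *Classifying the complexity of constraints using finite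
  algebras*, SIAM J. Comput. 34 (2005) 720–742 (the gadget reduction behind Prop. 3.1).
-/

namespace Literature.ModelTheory.FiniteModelTheory

open scoped _root_.FirstOrder
open _root_.FirstOrder.Language (Structure)
open _root_.FirstOrder.Language.Structure (RelMap)
open _root_.Relation
open Literature.Computability.Cryptography (relLanguage RelTables structureOfTables)

namespace PPPower

variable {ar br : List ℕ} {d : ℕ}

/-! ### Constraints of a table instance -/

/-- A CONSTRAINT of a table instance on `Fin n` over the vocabulary `br`: a relation symbol `s` and a
scope `v : Fin (arity s) → Fin n`. [cite: BartoOprsalPinsker2017, §2.2] -/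
abbrev Con (br : List ℕ) (n : ℕ) : Type := Σ s : Fin br.length, Fin (br.get s) → Fin n

/-- The constraints HOLDING in the tables `R`, symbol by symbol and, inside a table, by the number
`Σᵢ vᵢ nⁱ` of the scope (`finFunctionFinEquiv`). [cite: BartoOprsalPinsker2017, §2.2] -/
def conList {n : ℕ} (R : RelTables br n) : List (Con br n) :=
  (List.finRange br.length).flatMap fun s =>
    ((List.finRange (n ^ br.get s)).filter fun t => R s (finFunctionFinEquiv.symm t)).map
      fun t => ⟨s, finFunctionFinEquiv.symm t⟩

/-- `conList R` lists exactly the holding constraints. [folklore] -/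
theorem mem_conList_iff {n : ℕ} (R : RelTables br n) (c : Con br n) :
    c ∈ conList R ↔ R c.1 c.2 = true := by
  constructor
  · intro h
    simp only [conList, List.mem_flatMap, List.mem_finRange, true_and, List.mem_map,
      List.mem_filter] at h
    obtain ⟨s, t, ⟨ht, rfl⟩⟩ := h
    exact ht
  · intro h
    obtain ⟨s, v⟩ := c
    simp only [conList, List.mem_flatMap, List.mem_finRange, true_and, List.mem_map, List.mem_filter]
    refine ⟨s, finFunctionFinEquiv v, ⟨?_, ?_⟩⟩
    · rw [Equiv.symm_apply_apply]; exact h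
    · rw [Equiv.symm_apply_apply]

/-! ### The gadget system of a list of constraints -/

variable (P : PPPower (relLanguage ar) (relLanguage br) d)

/-- The pp-definition of the relation symbol `s` in the pp-power `P`. [cite: BartoOprsalPinsker2017, Def. 3.6] -/
abbrev fmla (s : Fin br.length) : PPFormula (relLanguage ar) (br.get s * d) :=
  P.relFormula (l := br.get s) ⟨s, rfl⟩

/-- Its number of existentially quantified variables. [cite: BartoOprsalPinsker2017, Def. 3.6] -/
abbrev nEx (s : Fin br.length) : ℕ := (P.fmla s).numExists

variable {n : ℕ} (C : List (Con br n))

/-- The VARIABLES of the gadget system of the constraint list `C`: `d` copies `(x, j)` of every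
element `x`, and a fresh block `⟨i, j⟩`, `j < e_{sᵢ}`, for the quantified variables of the gadget of
the `i`-th listed constraint. [cite: BartoOprsalPinsker2017, Prop. 3.1 (proof)] -/
abbrev SysVar : Type := (Fin n × Fin d) ⊕ (Σ i : Fin C.length, Fin (P.nEx (C.get i).1))

/-- The PLACEMENT of the `kd + e` variables of the gadget of the `i`-th listed constraint `⟨s, v⟩`:
free variable `j + d a ↦ (v a, j)`, quantified variable `j ↦ ⟨i, j⟩` (`gadgetAssign` in the list
indexing). [cite: BartoOprsalPinsker2017, Prop. 3.1 (proof)] -/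
def sysLoc (i : Fin C.length) : Fin (br.get (C.get i).1 * d + P.nEx (C.get i).1) → P.SysVar C :=
  Fin.append (flatten fun a j => Sum.inl ((C.get i).2 a, j)) fun j => Sum.inr ⟨i, j⟩

/-- The values of gadget `i` under an assignment `G`. [cite: BartoOprsalPinsker2017, Prop. 3.1 (proof)] -/
theorem comp_sysLoc {M : Type*} (G : P.SysVar C → M) (i : Fin C.length) :
    G ∘ P.sysLoc C i =
      Fin.append (flatten fun a j => G (Sum.inl ((C.get i).2 a, j))) fun j => G (Sum.inr ⟨i, j⟩) := by
  rw [sysLoc, comp_append, comp_flatten]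
  rfl

section System

variable {M : Type*} [(relLanguage ar).Structure M]

/-- `G` SOLVES GADGET `i`: every relational atom of the pp-definition of its symbol holds in `M` at
the placed variables, and the two sides of every equality atom get the same value.
[cite: BartoOprsalPinsker2017, Prop. 3.1 (proof)] -/
def SolvesAt (G : P.SysVar C → M) (i : Fin C.length) : Prop :=
  (∀ a ∈ (P.fmla (C.get i).1).rels, RelMap a.2.1 (G ∘ P.sysLoc C i ∘ a.2.2)) ∧
    ∀ e ∈ (P.fmla (C.get i).1).eqs, G (P.sysLoc C i e.1) = G (P.sysLoc C i e.2)

/-- `G` SOLVES THE GADGET SYSTEM of `C`. [cite: BartoOprsalPinsker2017, Prop. 3.1 (proof)] -/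
def Solves (G : P.SysVar C → M) : Prop := ∀ i, P.SolvesAt C G i

/-- A solution realizes the pp-definition of the symbol of every listed constraint at the copies of
its scope. [cite: BartoOprsalPinsker2017, Prop. 3.1 (proof)] -/
theorem Solves.realize {G : P.SysVar C → M} (hG : P.Solves C G) (i : Fin C.length) :
    (P.fmla (C.get i).1).Realize (M := M) (flatten fun a j => G (Sum.inl ((C.get i).2 a, j))) := by
  refine ⟨fun j => G (Sum.inr ⟨i, j⟩), fun a ha => ?_, fun e he => ?_⟩
  · have h := (hG i).1 a ha
    rwa [← Function.comp_assoc, comp_sysLoc] at h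
  · have h := (hG i).2 e he
    have h1 := congrFun (P.comp_sysLoc C G i) e.1
    have h2 := congrFun (P.comp_sysLoc C G i) e.2
    simp only [Function.comp_apply] at h1 h2
    rw [← h1, ← h2]
    exact h

/-- **THEOREM A (gadget replacement, system form).** If `C` lists exactly the constraints holding in
the tables `R`, the gadget system of `C` is solvable in `M` iff the instance `⟨Fin n, R⟩` maps
homomorphically to the pp-power `P.Carrier M`: (→) read off the `d` copies of each element, the
blocks witnessing the `∃`; (←) extend a homomorphism by witnesses, gadget by gadget.
[cite: BartoOprsalPinsker2017, Prop. 3.1] -/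
theorem exists_solves_iff (R : RelTables br n) (hC : ∀ c : Con br n, c ∈ C ↔ R c.1 c.2 = true) :
    (∃ G : P.SysVar C → M, P.Solves C G) ↔
      Nonempty (@FirstOrder.Language.Hom (relLanguage br) (Fin n) (P.Carrier M)
        (structureOfTables R) _) := by
  letI := structureOfTables R
  constructor
  · rintro ⟨G, hG⟩
    refine ⟨⟨fun x j => G (Sum.inl (x, j)), fun f => isEmptyElim f, ?_⟩⟩
    rintro l ⟨s, rfl⟩ v hv
    obtain ⟨i, hi⟩ := List.mem_iff_get.1 ((hC ⟨s, v⟩).2 hv)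
    have key : ∀ c : Con br n, C.get i = c →
        (P.fmla c.1).Realize (M := M) (flatten fun a j => G (Sum.inl (c.2 a, j))) := by
      rintro c rfl
      exact hG.realize P C i
    exact key ⟨s, v⟩ hi
  · rintro ⟨h⟩
    have hc : ∀ i : Fin C.length,
        (P.fmla (C.get i).1).Realize (M := M) (flatten (h ∘ (C.get i).2)) := fun i =>
      h.map_rel (⟨(C.get i).1, rfl⟩ : (relLanguage br).Relations (br.get (C.get i).1)) (C.get i).2
        ((hC (C.get i)).1 (List.get_mem C i))
    choose w hw using hc
    refine ⟨Sum.elim (fun p => h p.1 p.2) fun q => w q.1 q.2, fun i => ?_⟩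
    have key : Sum.elim (fun p => h p.1 p.2) (fun q => w q.1 q.2) ∘ P.sysLoc C i =
        Fin.append (flatten (h ∘ (C.get i).2)) (w i) :=
      P.comp_sysLoc C _ i
    refine ⟨fun a ha => ?_, fun e he => ?_⟩
    · rw [← Function.comp_assoc, key]
      exact (hw i).1 a ha
    · have h1 := congrFun key e.1
      have h2 := congrFun key e.2
      simp only [Function.comp_apply] at h1 h2
      rw [h1, h2]
      exact (hw i).2 e he

/-! ### The instance on the variables, tuples on representatives -/

/-- The EDGES of the system: the two placed sides of an equality atom of a gadget.
[cite: BartoOprsalPinsker2017, Prop. 3.1 (proof)] -/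
def SysEdge (a b : P.SysVar C) : Prop :=
  ∃ i : Fin C.length, ∃ e ∈ (P.fmla (C.get i).1).eqs, P.sysLoc C i e.1 = a ∧ P.sysLoc C i e.2 = b

/-- A solution is constant along the classes of the edges. [folklore] -/
theorem Solves.apply_eq_of_eqvGen {G : P.SysVar C → M} (hG : P.Solves C G) {a b : P.SysVar C}
    (h : EqvGen (P.SysEdge C) a b) : G a = G b := by
  induction h with
  | rel x y hxy =>
    obtain ⟨i, e, he, rfl, rfl⟩ := hxy
    exact (hG i).2 e he
  | refl x => rfl
  | symm x y _ ih => exact ih.symm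
  | trans x y z _ _ ih₁ ih₂ => exact ih₁.trans ih₂

variable (rep : P.SysVar C → P.SysVar C)

/-- THE INSTANCE OF `CSP(M)` ON THE VARIABLES: for a choice `rep` of representatives, `R₁(ū)` holds
iff `ū` is the image under `rep` of the placed variables of a relational atom `R₁(z̄)` of some
gadget. (Non-representatives remain as isolated points; the universe is not shrunk.)
[cite: BartoOprsalPinsker2017, Prop. 3.1 (proof)] -/
@[reducible] def sysStructure : (relLanguage ar).Structure (P.SysVar C) where
  RelMap := fun {l} r u => ∃ i : Fin C.length,
    ∃ z : Fin l → Fin (br.get (C.get i).1 * d + P.nEx (C.get i).1),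
      ⟨l, r, z⟩ ∈ (P.fmla (C.get i).1).rels ∧ u = rep ∘ P.sysLoc C i ∘ z

/-- **THEOREM B.** If `rep` identifies the two sides of every edge and moves every variable inside
its class, the instance on the variables maps homomorphically to `M` iff the gadget system is
solvable: (→) `g ∘ rep` solves it; (←) a solution is constant on classes, hence a homomorphism.
[cite: BartoOprsalPinsker2017, Prop. 3.1 (proof)] -/
theorem nonempty_sysHom_iff_exists_solves
    (rep_eq_of_sysEdge : ∀ a b, P.SysEdge C a b → rep a = rep b)
    (eqvGen_rep : ∀ u, EqvGen (P.SysEdge C) (rep u) u) :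
    Nonempty (@FirstOrder.Language.Hom (relLanguage ar) (P.SysVar C) M (P.sysStructure C rep) _) ↔
      ∃ G : P.SysVar C → M, P.Solves C G := by
  letI := P.sysStructure C rep
  constructor
  · rintro ⟨g⟩
    refine ⟨g ∘ rep, fun i => ⟨fun a ha => ?_, fun e he => ?_⟩⟩
    · exact g.map_rel a.2.1 (rep ∘ P.sysLoc C i ∘ a.2.2) ⟨i, a.2.2, ha, rfl⟩
    · simp only [Function.comp_apply]
      rw [rep_eq_of_sysEdge _ _ ⟨i, e, he, rfl, rfl⟩]
  · rintro ⟨G, hG⟩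
    have hrep : G ∘ rep = G := funext fun u => hG.apply_eq_of_eqvGen P C (eqvGen_rep u)
    refine ⟨⟨G, fun f => isEmptyElim f, ?_⟩⟩
    rintro l r u ⟨i, z, hz, rfl⟩
    rw [← Function.comp_assoc, hrep]
    exact (hG i).1 ⟨l, r, z⟩ hz

/-- **Gadget replacement for the instance on the variables**: with `C` the holding constraints of `R`
and `rep` a choice of representatives, the instance maps homomorphically to `M` iff `⟨Fin n, R⟩` maps
homomorphically to the pp-power `P.Carrier M`. [cite: BartoOprsalPinsker2017, Prop. 3.1] -/
theorem nonempty_sysHom_iff (R : RelTables br n) (hC : ∀ c : Con br n, c ∈ C ↔ R c.1 c.2 = true)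
    (rep_eq_of_sysEdge : ∀ a b, P.SysEdge C a b → rep a = rep b)
    (eqvGen_rep : ∀ u, EqvGen (P.SysEdge C) (rep u) u) :
    Nonempty (@FirstOrder.Language.Hom (relLanguage ar) (P.SysVar C) M (P.sysStructure C rep) _) ↔
      Nonempty (@FirstOrder.Language.Hom (relLanguage br) (Fin n) (P.Carrier M)
        (structureOfTables R) _) :=
  (P.nonempty_sysHom_iff_exists_solves C rep rep_eq_of_sysEdge eqvGen_rep).trans
    (P.exists_solves_iff C R hC)

end System

end PPPower

end Literature.ModelTheory.FiniteModelTheory
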